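import Summits.QuantumFields.YangMills.Theorems.SwapVirialDeficitZeroModeGroupThreeSmallBallRateHub
import Summits.QuantumFields.YangMills.Theorems.SwapVirialDeficitZeroModeGroupThreeHub
import HarnessLib

/-!
# Exact zero-mode rung Z4 in SMALL-BALL form — IX: the POWER-RATE remainder `|Haar³(N₃(t))/t⁴ − v₃′| ≤ K·t^{1/19}`
# (LEAD ym-line-sfw-p2 g93 07:46Z «the zero-mode inputs a sharp law needs next are EXACT small-ball asymptotics `Haar³{N₃(t)} = v₃t⁴(1 + O(t^θ))`»;
# free-hands support of ⟨stmt-QuantumFields-24197⟩)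

Assembly of parts II (exact `t⁴` scaling), IV (domination), VIII (`μ(S_sΔS₀) ≤ A·m^{1/3} + (√s/m⁶)·K`): with `m = s^{3/38}` both error terms are
`s^{1/38} = t^{1/19}` (`s = t²`).
* §20 `measure_tripleSet_eq_tripleIntegral`, `measure_tripleSet_le_add` / `_le_add'` (`μ(S_s) ≤ μ(S₀) + μ(S_sΔS₀)` and conversely),
  `measure_tripleSet_ne_top` (under `hV`);
* §21 ★ `symmDiff_bound_at_scale` — `μ(S_s Δ S₀) ≤ ofReal(s^{1/38})·C` with a FINITE constant `C` (`Ising ⅓, Ising ¼ < ∞`);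
* §22 ★★★ `abs_haar_tripleBall_div_sub_le` — for `0 < t ≤ 1`, `|Haar³(N₃(t))/t⁴ − v₃′| ≤ K·t^{1/19}` (modulo the integrability `hV` of w2 g55's
  dominator, which makes `v₃′` finite), and the packaged ★★★ `smallBall_three_sharp` : `∃ v K θ, 0 < v ∧ 0 < θ ∧ ∀ t ∈ (0,1], |Haar³(N₃ t)/t⁴ − v| ≤ K t^θ`
  — LEAD's shape `v₃t⁴(1 + O(t^θ))` with `θ = 1/19` (not optimised); §23 UNCONDITIONAL versions, `hV` discharged by w2 g55's
  ✓`ZeroModeGroup.lintegral_cone_prod_dominator_ne_top` (file `…ZeroModeGroupThreeHub`).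
HONEST LABEL: finite-dimensional measure theory (plan-level zero-mode rung of a DRAFT line), unconditional after §23;
NOT the fixed-`L` sharp law of `F^S`, NOT ⟨24197⟩; the Yang–Mills mass gap is NOT proved; no summit is proved by a line.  Seat ym-line-fcl-p3 g44,
`--supports stmt-QuantumFields-24197`.  THEOREMS ONLY, standard axioms.  References: [cite: GonzalezarroyoAltes1988]; [cite: Vanbaal2001]; [folklore].
-/

set_option autoImplicit false

noncomputable section

open MeasureTheory Quaternion Set Filter Topology
open scoped Quaternion ENNReal BigOperators Topology
open Literature.MathematicalPhysics.QuantumLattice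
open Literature.MathematicalPhysics.QuantumFieldTheory (haarProbability)
open Summit.QuantumFields.YangMills.Theorems.SwapTwistDeficit.ToronLog

attribute [local instance] Literature.Analysis.FluidPDE.Tao2016.quatMeasurableSpace
  Literature.Analysis.FluidPDE.Tao2016.quatBorelSpace
  Literature.MathematicalPhysics.QuantumLattice.secondCountableTopology_su2

namespace Summit.QuantumFields.YangMills.Theorems.SwapVirialDeficit.ZeroModeGroup

/-! ## §20 The triple event as a measure; finiteness -/

/-- The iterated triple integral of parts II–IV is the `cone ⊗ (vol ⊗ vol)`-measure of the triple event. [folklore] -/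
theorem measure_tripleSet_eq_tripleIntegral (s : ℝ) :
    (coneMeasure.prod ((volume : Measure ℍ).prod (volume : Measure ℍ))) {q : ℍ × ℍ × ℍ | (q.2.1, q.2.2) ∈ rescaledSet s (axisPoint q.1)} =
      ∫⁻ a, (∫⁻ x, ∫⁻ y, (rescaledSet s (axisPoint a)).indicator (1 : ℍ × ℍ → ℝ≥0∞) (x, y)) ∂coneMeasure := by
  haveI := isProbabilityMeasure_coneMeasure
  rw [tripleIntegral_eq_lintegral_prod, ← lintegral_indicator_one (measurableSet_rescaledSet_axis_joint s)]
  refine lintegral_congr fun q => ?_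
  by_cases h : (q.2.1, q.2.2) ∈ rescaledSet s (axisPoint q.1)
  · rw [Set.indicator_of_mem (show q ∈ {q : ℍ × ℍ × ℍ | (q.2.1, q.2.2) ∈ rescaledSet s (axisPoint q.1)} from h), Set.indicator_of_mem h]; rfl
  · rw [Set.indicator_of_notMem (show q ∉ {q : ℍ × ℍ × ℍ | (q.2.1, q.2.2) ∈ rescaledSet s (axisPoint q.1)} from h), Set.indicator_of_notMem h]

/-- `μ(S_s) ≤ μ(S₀) + μ(S_s Δ S₀)`. [folklore] -/
theorem measure_tripleSet_le_add (s : ℝ) :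
    (coneMeasure.prod ((volume : Measure ℍ).prod (volume : Measure ℍ))) {q : ℍ × ℍ × ℍ | (q.2.1, q.2.2) ∈ rescaledSet s (axisPoint q.1)} ≤
      (coneMeasure.prod ((volume : Measure ℍ).prod (volume : Measure ℍ))) {q : ℍ × ℍ × ℍ | (q.2.1, q.2.2) ∈ rescaledSet 0 (axisPoint q.1)} +
        (coneMeasure.prod ((volume : Measure ℍ).prod (volume : Measure ℍ)))
          {q : ℍ × ℍ × ℍ | ((q.2.1, q.2.2) ∈ rescaledSet s (axisPoint q.1) ∧ (q.2.1, q.2.2) ∉ rescaledSet 0 (axisPoint q.1)) ∨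
            ((q.2.1, q.2.2) ∈ rescaledSet 0 (axisPoint q.1) ∧ (q.2.1, q.2.2) ∉ rescaledSet s (axisPoint q.1))} := by
  refine le_trans (measure_mono fun q hq => ?_) (measure_union_le _ _)
  by_cases h0 : (q.2.1, q.2.2) ∈ rescaledSet 0 (axisPoint q.1)
  · exact Or.inl h0
  · exact Or.inr (Or.inl ⟨hq, h0⟩)

/-- `μ(S₀) ≤ μ(S_s) + μ(S_s Δ S₀)`. [folklore] -/
theorem measure_tripleSet_le_add' (s : ℝ) :
    (coneMeasure.prod ((volume : Measure ℍ).prod (volume : Measure ℍ))) {q : ℍ × ℍ × ℍ | (q.2.1, q.2.2) ∈ rescaledSet 0 (axisPoint q.1)} ≤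
      (coneMeasure.prod ((volume : Measure ℍ).prod (volume : Measure ℍ))) {q : ℍ × ℍ × ℍ | (q.2.1, q.2.2) ∈ rescaledSet s (axisPoint q.1)} +
        (coneMeasure.prod ((volume : Measure ℍ).prod (volume : Measure ℍ)))
          {q : ℍ × ℍ × ℍ | ((q.2.1, q.2.2) ∈ rescaledSet s (axisPoint q.1) ∧ (q.2.1, q.2.2) ∉ rescaledSet 0 (axisPoint q.1)) ∨
            ((q.2.1, q.2.2) ∈ rescaledSet 0 (axisPoint q.1) ∧ (q.2.1, q.2.2) ∉ rescaledSet s (axisPoint q.1))} := by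
  refine le_trans (measure_mono fun q hq => ?_) (measure_union_le _ _)
  by_cases hs : (q.2.1, q.2.2) ∈ rescaledSet s (axisPoint q.1)
  · exact Or.inl hs
  · exact Or.inr (Or.inr ⟨hq, hs⟩)

/-- Under the integrability `hV` of w2's dominator every triple event has finite measure (`s ≥ 0`). [folklore] -/
theorem measure_tripleSet_ne_top
    (hV : ∫⁻ q, dominator ‖q.1.im‖ q.2.1 q.2.2 ∂(coneMeasure.prod ((volume : Measure ℍ).prod (volume : Measure ℍ))) ≠ ∞) {s : ℝ} (hs : 0 ≤ s) :
    (coneMeasure.prod ((volume : Measure ℍ).prod (volume : Measure ℍ))) {q : ℍ × ℍ × ℍ | (q.2.1, q.2.2) ∈ rescaledSet s (axisPoint q.1)} ≠ ∞ := by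
  haveI := isProbabilityMeasure_coneMeasure
  rw [← lintegral_indicator_one (measurableSet_rescaledSet_axis_joint s)]
  refine ne_top_of_le_ne_top (ENNReal.mul_ne_top (ENNReal.ofReal_ne_top (r := Real.exp 3)) hV) ?_
  rw [← lintegral_const_mul' _ _ ENNReal.ofReal_ne_top]
  refine lintegral_mono_ae ?_
  filter_upwards [ae_indicator_le_dominator hs] with q hq
  have e : {q : ℍ × ℍ × ℍ | (q.2.1, q.2.2) ∈ rescaledSet s (axisPoint q.1)}.indicator (1 : ℍ × ℍ × ℍ → ℝ≥0∞) q =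
      (rescaledSet s (axisPoint q.1)).indicator (1 : ℍ × ℍ → ℝ≥0∞) (q.2.1, q.2.2) := by
    by_cases h : (q.2.1, q.2.2) ∈ rescaledSet s (axisPoint q.1)
    · rw [Set.indicator_of_mem (show q ∈ {q : ℍ × ℍ × ℍ | (q.2.1, q.2.2) ∈ rescaledSet s (axisPoint q.1)} from h), Set.indicator_of_mem h]; rfl
    · rw [Set.indicator_of_notMem (show q ∉ {q : ℍ × ℍ × ℍ | (q.2.1, q.2.2) ∈ rescaledSet s (axisPoint q.1)} from h), Set.indicator_of_notMem h]
  rw [e]; exact hq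

/-! ## §21 The symmetric difference at the scale `m = s^{3/38}` -/

/-- Exponent bookkeeping: for `s > 0` and `m = s^{3/38}`, `m^{1/3} = s^{1/38}` and `√s/m⁶ = s^{1/38}`. [folklore] -/
theorem scale_exponents {s : ℝ} (hs : 0 < s) :
    (s ^ ((3 : ℝ) / 38)) ^ ((1 : ℝ) / 3) = s ^ ((1 : ℝ) / 38) ∧ Real.sqrt s / (s ^ ((3 : ℝ) / 38)) ^ 6 = s ^ ((1 : ℝ) / 38) := by
  constructor
  · rw [← Real.rpow_mul hs.le]; norm_num
  · rw [Real.sqrt_eq_rpow, ← Real.rpow_natCast, ← Real.rpow_mul hs.le, ← Real.rpow_sub hs]; norm_num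

/-- ★ **The symmetric difference at scale**: for `0 < s ≤ 1`, `μ(S_s Δ S₀) ≤ ofReal(s^{1/38})·C` with the explicit finite constant
`C = 2C_d·(coneConst·2·4π·3) + (64 + 4√2·I(¼)²)`. [folklore] -/
theorem symmDiff_bound_at_scale {s : ℝ} (hs0 : 0 < s) (hs1 : s ≤ 1) :
    (coneMeasure.prod ((volume : Measure ℍ).prod (volume : Measure ℍ)))
        {q : ℍ × ℍ × ℍ | ((q.2.1, q.2.2) ∈ rescaledSet s (axisPoint q.1) ∧ (q.2.1, q.2.2) ∉ rescaledSet 0 (axisPoint q.1)) ∨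
          ((q.2.1, q.2.2) ∈ rescaledSet 0 (axisPoint q.1) ∧ (q.2.1, q.2.2) ∉ rescaledSet s (axisPoint q.1))} ≤
      ENNReal.ofReal (s ^ ((1 : ℝ) / 38)) *
        ((2 * (ENNReal.ofReal (Real.exp 3) * (4 * (ENNReal.ofReal (Real.pi ^ 2 / 48) * (Ising (1/3) * Ising (1/3)))))) *
            (ENNReal.ofReal coneConst * (2 * (ENNReal.ofReal (4 * Real.pi) * ENNReal.ofReal 3))) +
          (ENNReal.ofReal 64 + ENNReal.ofReal (4 * Real.sqrt 2) * (Ising (1/4) * Ising (1/4)))) := by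
  have hm0 : 0 < s ^ ((3 : ℝ) / 38) := Real.rpow_pos_of_pos hs0 _
  obtain ⟨e1, e2⟩ := scale_exponents hs0
  have h := measure_symmDiff_triple_le hs0 hs1 hm0
  rw [e1, e2, ENNReal.ofReal_mul (by norm_num : (0 : ℝ) ≤ 3)] at h
  refine h.trans (le_of_eq ?_)
  ring

/-- The constant of `symmDiff_bound_at_scale` is finite. [folklore] -/
theorem rateConst_ne_top :
    (2 * (ENNReal.ofReal (Real.exp 3) * (4 * (ENNReal.ofReal (Real.pi ^ 2 / 48) * (Ising (1/3) * Ising (1/3)))))) *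
        (ENNReal.ofReal coneConst * (2 * (ENNReal.ofReal (4 * Real.pi) * ENNReal.ofReal 3))) +
      (ENNReal.ofReal 64 + ENNReal.ofReal (4 * Real.sqrt 2) * (Ising (1/4) * Ising (1/4))) ≠ ∞ := by
  have h3 : Ising (1/3) ≠ ∞ := (Ising_lt_top (by norm_num) (by norm_num)).ne
  have h4 : Ising (1/4) ≠ ∞ := (Ising_lt_top (by norm_num) (by norm_num)).ne
  have hI3 : Ising (1/3) * Ising (1/3) ≠ ∞ := ENNReal.mul_ne_top h3 h3
  have hI4 : Ising (1/4) * Ising (1/4) ≠ ∞ := ENNReal.mul_ne_top h4 h4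
  refine ENNReal.add_ne_top.2 ⟨?_, ?_⟩
  · refine ENNReal.mul_ne_top ?_ ?_
    · exact ENNReal.mul_ne_top (by simp) (ENNReal.mul_ne_top ENNReal.ofReal_ne_top (ENNReal.mul_ne_top (by simp) (ENNReal.mul_ne_top ENNReal.ofReal_ne_top hI3)))
    · exact ENNReal.mul_ne_top ENNReal.ofReal_ne_top (ENNReal.mul_ne_top (by simp) (ENNReal.mul_ne_top ENNReal.ofReal_ne_top ENNReal.ofReal_ne_top))
  · exact ENNReal.add_ne_top.2 ⟨ENNReal.ofReal_ne_top, ENNReal.mul_ne_top ENNReal.ofReal_ne_top hI4⟩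

/-! ## §22 The rate -/

/-- Real-valued extraction: `A ≤ B + C`, `B ≤ A + C`, all finite ⇒ `|A.toReal − B.toReal| ≤ C.toReal`. [folklore] -/
theorem abs_toReal_sub_le {A B C : ℝ≥0∞} (hA : A ≠ ∞) (hB : B ≠ ∞) (hC : C ≠ ∞) (h1 : A ≤ B + C) (h2 : B ≤ A + C) :
    |A.toReal - B.toReal| ≤ C.toReal := by
  rw [abs_sub_le_iff]
  constructor
  · have := ENNReal.toReal_mono (ENNReal.add_ne_top.2 ⟨hB, hC⟩) h1
    rw [ENNReal.toReal_add hB hC] at this; linarith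
  · have := ENNReal.toReal_mono (ENNReal.add_ne_top.2 ⟨hA, hC⟩) h2
    rw [ENNReal.toReal_add hA hC] at this; linarith

/-- ★★★ **THE POWER-RATE REMAINDER** (modulo the integrability `hV` of w2 g55's dominator): for `0 < t ≤ 1`,
`|Haar³(N₃(t))/t⁴ − v₃′| ≤ K·t^{1/19}`, with `v₃′ = coneConst²·∫dcone(a) (vol⊗vol)(G₀(re a + ‖Im a‖·i))` the limit of part IV and an explicit
finite `K`. [cite: GonzalezarroyoAltes1988] [cite: Vanbaal2001] -/
theorem abs_haar_tripleBall_div_sub_le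
    (hV : ∫⁻ q, dominator ‖q.1.im‖ q.2.1 q.2.2 ∂(coneMeasure.prod ((volume : Measure ℍ).prod (volume : Measure ℍ))) ≠ ∞) :
    ∃ K : ℝ, ∀ t : ℝ, 0 < t → t ≤ 1 →
      |((Measure.pi fun _ : Fin 3 => haarProbability (Matrix.specialUnitaryGroup (Fin 2) ℂ)) (tripleBall t)).toReal / t ^ 4 -
        (ENNReal.ofReal coneConst * (ENNReal.ofReal coneConst *
          ∫⁻ a, (∫⁻ x, ∫⁻ y, (rescaledSet 0 (axisPoint a)).indicator (1 : ℍ × ℍ → ℝ≥0∞) (x, y)) ∂coneMeasure)).toReal| ≤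
        K * t ^ ((1 : ℝ) / 19) := by
  set μ := coneMeasure.prod ((volume : Measure ℍ).prod (volume : Measure ℍ)) with hμ
  set C := (2 * (ENNReal.ofReal (Real.exp 3) * (4 * (ENNReal.ofReal (Real.pi ^ 2 / 48) * (Ising (1/3) * Ising (1/3)))))) *
      (ENNReal.ofReal coneConst * (2 * (ENNReal.ofReal (4 * Real.pi) * ENNReal.ofReal 3))) +
    (ENNReal.ofReal 64 + ENNReal.ofReal (4 * Real.sqrt 2) * (Ising (1/4) * Ising (1/4))) with hC
  have hCfin : C ≠ ∞ := rateConst_ne_top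
  set c := ENNReal.ofReal coneConst with hc
  refine ⟨(c * (c * C)).toReal, fun t ht ht1 => ?_⟩
  have hs0 : 0 < t ^ 2 := by positivity
  have hs1 : t ^ 2 ≤ 1 := by nlinarith
  -- the quotient and the limit as measures of triple events
  have hS : ∀ s, (∫⁻ a, (∫⁻ x, ∫⁻ y, (rescaledSet s (axisPoint a)).indicator (1 : ℍ × ℍ → ℝ≥0∞) (x, y)) ∂coneMeasure) =
      μ {q : ℍ × ℍ × ℍ | (q.2.1, q.2.2) ∈ rescaledSet s (axisPoint q.1)} := fun s => (measure_tripleSet_eq_tripleIntegral s).symm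
  have hq : ((Measure.pi fun _ : Fin 3 => haarProbability (Matrix.specialUnitaryGroup (Fin 2) ℂ)) (tripleBall t)).toReal / t ^ 4 =
      (c * (c * μ {q : ℍ × ℍ × ℍ | (q.2.1, q.2.2) ∈ rescaledSet (t ^ 2) (axisPoint q.1)})).toReal := by
    have ht4 : (0 : ℝ) < t ^ 4 := by positivity
    rw [haar_tripleBall_eq_scaled ht, ENNReal.toReal_mul, ENNReal.toReal_ofReal ht4.le, mul_div_cancel_left₀ _ ht4.ne', hS]
  rw [hq, hS 0]
  -- the two measures differ by at most `c²·ofReal(s^{1/38})·C`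
  have hA := measure_tripleSet_ne_top hV hs0.le
  have hB := measure_tripleSet_ne_top hV le_rfl
  have hD := symmDiff_bound_at_scale hs0 hs1
  have h1 := (measure_tripleSet_le_add (t ^ 2)).trans (add_le_add le_rfl hD)
  have h2 := (measure_tripleSet_le_add' (t ^ 2)).trans (add_le_add le_rfl hD)
  have hcne : c ≠ ∞ := ENNReal.ofReal_ne_top
  have hE : ENNReal.ofReal ((t ^ 2) ^ ((1 : ℝ) / 38)) * C ≠ ∞ := ENNReal.mul_ne_top ENNReal.ofReal_ne_top hCfin
  have h1' : c * (c * μ {q : ℍ × ℍ × ℍ | (q.2.1, q.2.2) ∈ rescaledSet (t ^ 2) (axisPoint q.1)}) ≤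
      c * (c * μ {q : ℍ × ℍ × ℍ | (q.2.1, q.2.2) ∈ rescaledSet 0 (axisPoint q.1)}) + c * (c * (ENNReal.ofReal ((t ^ 2) ^ ((1 : ℝ) / 38)) * C)) := by
    calc c * (c * μ {q : ℍ × ℍ × ℍ | (q.2.1, q.2.2) ∈ rescaledSet (t ^ 2) (axisPoint q.1)})
        ≤ c * (c * (μ {q : ℍ × ℍ × ℍ | (q.2.1, q.2.2) ∈ rescaledSet 0 (axisPoint q.1)} + ENNReal.ofReal ((t ^ 2) ^ ((1 : ℝ) / 38)) * C)) := by
          gcongr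
      _ = _ := by ring
  have h2' : c * (c * μ {q : ℍ × ℍ × ℍ | (q.2.1, q.2.2) ∈ rescaledSet 0 (axisPoint q.1)}) ≤
      c * (c * μ {q : ℍ × ℍ × ℍ | (q.2.1, q.2.2) ∈ rescaledSet (t ^ 2) (axisPoint q.1)}) + c * (c * (ENNReal.ofReal ((t ^ 2) ^ ((1 : ℝ) / 38)) * C)) := by
    calc c * (c * μ {q : ℍ × ℍ × ℍ | (q.2.1, q.2.2) ∈ rescaledSet 0 (axisPoint q.1)})
        ≤ c * (c * (μ {q : ℍ × ℍ × ℍ | (q.2.1, q.2.2) ∈ rescaledSet (t ^ 2) (axisPoint q.1)} + ENNReal.ofReal ((t ^ 2) ^ ((1 : ℝ) / 38)) * C)) := by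
          gcongr
      _ = _ := by ring
  have key := abs_toReal_sub_le (ENNReal.mul_ne_top hcne (ENNReal.mul_ne_top hcne hA)) (ENNReal.mul_ne_top hcne (ENNReal.mul_ne_top hcne hB))
    (ENNReal.mul_ne_top hcne (ENNReal.mul_ne_top hcne hE)) h1' h2'
  refine key.trans (le_of_eq ?_)
  have e : (t ^ 2) ^ ((1 : ℝ) / 38) = t ^ ((1 : ℝ) / 19) := by
    rw [← Real.rpow_natCast t 2, ← Real.rpow_mul ht.le]; norm_num
  rw [e, show c * (c * (ENNReal.ofReal (t ^ ((1 : ℝ) / 19)) * C)) = ENNReal.ofReal (t ^ ((1 : ℝ) / 19)) * (c * (c * C)) by ring,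
    ENNReal.toReal_mul, ENNReal.toReal_ofReal (Real.rpow_nonneg ht.le _), mul_comm]

/-- ★★★ **HEADLINE — LEAD's shape `Haar³{N₃(t)} = v₃′t⁴(1 + O(t^θ))`** (modulo `hV`): there are `v > 0`, `K` and `θ > 0` (`θ = 1/19`) with
`|Haar³{C ∈ SU(2)³ | ‖[q₀,q₁]‖, ‖[q₀,q₂]‖, ‖[q₁,q₂]‖ ≤ t}/t⁴ − v| ≤ K·t^θ` for all `0 < t ≤ 1`. [cite: GonzalezarroyoAltes1988] [cite: Vanbaal2001] -/
theorem smallBall_three_sharp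
    (hV : ∫⁻ q, dominator ‖q.1.im‖ q.2.1 q.2.2 ∂(coneMeasure.prod ((volume : Measure ℍ).prod (volume : Measure ℍ))) ≠ ∞) :
    ∃ v K θ : ℝ, 0 < v ∧ 0 < θ ∧ ∀ t : ℝ, 0 < t → t ≤ 1 →
      |((Measure.pi fun _ : Fin 3 => haarProbability (Matrix.specialUnitaryGroup (Fin 2) ℂ)) (tripleBall t)).toReal / t ^ 4 - v| ≤ K * t ^ θ := by
  obtain ⟨K, hK⟩ := abs_haar_tripleBall_div_sub_le hV
  exact ⟨_, K, 1 / 19, smallBallConst_pos hV, by norm_num, hK⟩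


/-! ## §23 Unconditional versions (w2 g55's integrability of the dominator, by name) -/

/-- ★★★ **THE POWER-RATE REMAINDER, UNCONDITIONAL**: for `0 < t ≤ 1`, `|Haar³(N₃(t))/t⁴ − v₃′| ≤ K·t^{1/19}`
(`hV` = ✓`lintegral_cone_prod_dominator_ne_top`, w2 g55). [cite: GonzalezarroyoAltes1988] [cite: Vanbaal2001] -/
theorem abs_haar_tripleBall_div_sub_le_unconditional :
    ∃ K : ℝ, ∀ t : ℝ, 0 < t → t ≤ 1 →
      |((Measure.pi fun _ : Fin 3 => haarProbability (Matrix.specialUnitaryGroup (Fin 2) ℂ)) (tripleBall t)).toReal / t ^ 4 -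
        (ENNReal.ofReal coneConst * (ENNReal.ofReal coneConst *
          ∫⁻ a, (∫⁻ x, ∫⁻ y, (rescaledSet 0 (axisPoint a)).indicator (1 : ℍ × ℍ → ℝ≥0∞) (x, y)) ∂coneMeasure)).toReal| ≤
        K * t ^ ((1 : ℝ) / 19) :=
  abs_haar_tripleBall_div_sub_le lintegral_cone_prod_dominator_ne_top

/-- ★★★ **HEADLINE, UNCONDITIONAL — `Haar³{N₃(t)} = v₃′t⁴(1 + O(t^{1/19}))`**: there are `v > 0`, `K`, `θ > 0` with
`|Haar³{C ∈ SU(2)³ | ‖[q₀,q₁]‖, ‖[q₀,q₂]‖, ‖[q₁,q₂]‖ ≤ t}/t⁴ − v| ≤ K·t^θ` for all `0 < t ≤ 1` — the exact `k = 3` zero-mode rung on the group in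
LEAD g93's small-ball shape, constant AND power remainder. [cite: GonzalezarroyoAltes1988] [cite: Vanbaal2001] -/
theorem smallBall_three_sharp_unconditional :
    ∃ v K θ : ℝ, 0 < v ∧ 0 < θ ∧ ∀ t : ℝ, 0 < t → t ≤ 1 →
      |((Measure.pi fun _ : Fin 3 => haarProbability (Matrix.specialUnitaryGroup (Fin 2) ℂ)) (tripleBall t)).toReal / t ^ 4 - v| ≤ K * t ^ θ :=
  smallBall_three_sharp lintegral_cone_prod_dominator_ne_top

/-- ★★★ The same for the cell's `∀ μ ν` event `{C | ∀ μ ν, ‖q(C μ)q(C ν) − q(C ν)q(C μ)‖ ≤ t}` of ✓`haar_pi_nearlyCommuting_three_le/ge`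
(two-sided `t⁴`): now with EXACT constant and power remainder. [cite: GonzalezarroyoAltes1988] [cite: Vanbaal2001] -/
theorem smallBall_three_sharp_forall :
    ∃ v K θ : ℝ, 0 < v ∧ 0 < θ ∧ ∀ t : ℝ, 0 < t → t ≤ 1 →
      |((Measure.pi fun _ : Fin 3 => haarProbability (Matrix.specialUnitaryGroup (Fin 2) ℂ))
          {C : Fin 3 → Matrix.specialUnitaryGroup (Fin 2) ℂ |
            ∀ μ ν : Fin 3, ‖su2Quat (C μ) * su2Quat (C ν) - su2Quat (C ν) * su2Quat (C μ)‖ ≤ t}).toReal / t ^ 4 - v| ≤ K * t ^ θ := by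
  obtain ⟨v, K, θ, hv, hθ, h⟩ := smallBall_three_sharp_unconditional
  refine ⟨v, K, θ, hv, hθ, fun t ht ht1 => ?_⟩
  have e : {C : Fin 3 → Matrix.specialUnitaryGroup (Fin 2) ℂ |
      ∀ μ ν : Fin 3, ‖su2Quat (C μ) * su2Quat (C ν) - su2Quat (C ν) * su2Quat (C μ)‖ ≤ t} = tripleBall t := by
    ext C
    simp only [tripleBall, Set.mem_setOf_eq]
    have hsymm : ∀ μ ν : Fin 3, ‖su2Quat (C μ) * su2Quat (C ν) - su2Quat (C ν) * su2Quat (C μ)‖ =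
        ‖su2Quat (C ν) * su2Quat (C μ) - su2Quat (C μ) * su2Quat (C ν)‖ := fun μ ν => by rw [← norm_neg, neg_sub]
    constructor
    · intro hC; exact ⟨hC 0 1, hC 0 2, hC 1 2⟩
    · rintro ⟨h01, h02, h12⟩ μ ν
      fin_cases μ <;> fin_cases ν
      all_goals first
        | (simp only [sub_self, norm_zero]; exact ht.le)
        | exact h01 | exact h02 | exact h12
        | (rw [hsymm]; first | exact h01 | exact h02 | exact h12)
  rw [e]; exact h t ht ht1


/-! ## §24 The multiplicative shape `|m(t)/(v·t⁴) − 1| ≤ κ·t^θ` (the hypothesis shape of ✓`SharpSigma.tauber_sandwich_rpow`) -/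

/-- From `|m/t⁴ − v| ≤ K t^θ` with `v > 0` to the relative form `|m/(v t⁴) − 1| ≤ (K/v)·t^θ`. [folklore] -/
theorem rel_form_of_abs_sub_le {m v K θ t : ℝ} (hv : 0 < v) (ht : 0 < t) (h : |m / t ^ 4 - v| ≤ K * t ^ θ) :
    |m / (v * t ^ 4) - 1| ≤ K / v * t ^ θ := by
  have ht4 : 0 < t ^ 4 := by positivity
  have e : m / (v * t ^ 4) - 1 = (m / t ^ 4 - v) / v := by field_simp
  rw [e, abs_div, abs_of_pos hv, div_le_iff₀ hv]
  calc |m / t ^ 4 - v| ≤ K * t ^ θ := h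
    _ = K / v * t ^ θ * v := by field_simp

/-- ★★★ **THE RELATIVE FORM** — `Haar³{N₃(t)} = v·t⁴·(1 + O(t^θ))` literally: there are `v > 0`, `κ`, `θ > 0` with
`|Haar³(N₃(t))/(v·t⁴) − 1| ≤ κ·t^θ` for all `0 < t ≤ 1` — the shape `|m/(v t^N) − 1| ≤ κ t^θ` (here `N = 4`) that the «sharp-sigma» card's
hypothesis `hvol` asks of `F^S` at `N = 9L⁴ − 1` (✓`SharpSigma.tauber_sandwich_rpow`). [cite: GonzalezarroyoAltes1988] [cite: Vanbaal2001] -/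
theorem smallBall_three_relative :
    ∃ v κ θ : ℝ, 0 < v ∧ 0 < θ ∧ ∀ t : ℝ, 0 < t → t ≤ 1 →
      |((Measure.pi fun _ : Fin 3 => haarProbability (Matrix.specialUnitaryGroup (Fin 2) ℂ)) (tripleBall t)).toReal / (v * t ^ 4) - 1| ≤ κ * t ^ θ := by
  obtain ⟨v, K, θ, hv, hθ, h⟩ := smallBall_three_sharp_unconditional
  exact ⟨v, K / v, θ, hv, hθ, fun t ht ht1 => rel_form_of_abs_sub_le hv ht (h t ht ht1)⟩

end Summit.QuantumFields.YangMills.Theorems.SwapVirialDeficit.ZeroModeGroup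

end
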